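import Literature.Probability.Moments.PoincareExponentialIntegrability
import Summits.QuantumFields.YangMills.Theorems.PoincareLipschitzMesoscopicConcentrationOfEntropy
import HarnessLib

/-!
# Crux `HistoryTailL` (stmt-QuantumFields-19936), line #12 organ K1 — THE POINCARÉ DOOR (Gromov–Milman):
# K1-exp ⟸ a variance (spectral-gap ∕ Poincaré) bound for `e^{lf/2}` at the Hodge–Poincaré scale `n²Λ²∕β_K`

Cell `ym3-torus` (YM ladder rung R3 = continuum SU(2) Yang–Mills on the 3-torus — NOT d = 4, NOT infinite volume, NOT a mass gap, NOT the Clay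
problem), width seat `ym-ust-19936-w3` gen 13; companion of ★w4 g12's Herbst door ✓`PoincareLipschitzMesoscopicConcentrationOfEntropy`
(the log-Sobolev face of K1) and of the p-linear glue ✓`PoincareLipschitzLinear.historyTailL_of_expConcentration`
(`HistoryTailL ⟸ K1-exp ∧ BlockLipschitzL ∧ MeanDeviationL`).  `--supports stmt-QuantumFields-19936 --as helper`.

WHAT THIS FILE PROVES (a door, S–M): the text K1-exp — the deciding crux `PoincareLipschitz.MesoscopicConcentrationL` (stmt-QuantumFields-23532,
NOT claimed, NOT restated as a definition, NOT proved) with its Gaussian profile replaced by the EXPONENTIAL profile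
`Cc·exp(−cc·√β_K·r∕(n·Λ))`, i.e. VERBATIM the hypothesis `hC` of ✓`historyTailL_of_expConcentration` — follows, with `Cc = e²` and
`cc = 1∕√(2·cV)`, from ONE displayed functional-inequality hypothesis `hVar` on exactly the crux's class of observables:

  for every box-local, gauge-invariant, measurable, `Λ`-Lipschitz (`ℓ²` link metric) `f` and every real `l`,
  `Var_{gibbsK}(e^{lf∕2}) = ∫ e^{lf} d gibbsK − (∫ e^{(l∕2)f} d gibbsK)² ≤ cV·(n²Λ²∕β_K)·l²·∫ e^{lf} d gibbsK`

— the already-integrated form in which a POINCARÉ (spectral-gap) inequality for `gibbsK` with constant `≍ n²∕β_K` on that class (and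
`|∇f| ≤ Λ`, so `|∇e^{lf∕2}|² ≤ (l²Λ²∕4)e^{lf}`) is consumed by the Gromov–Milman ∕ Aida–Stroock doubling argument; the probabilistic step is
the tree's kernel-proved ✓`Literature.Probability.Moments.poincare_laplace_and_tail_bound` (Bakry–Gentil–Ledoux Prop. 4.4.2), applicable
because every `f` of the class is bounded (✓`PoincareLipschitzMesoscopicConcentrationOfEntropy.abs_le_of_lipschitz`).

* `sqrt_two_mul_scale` — the scale identity `√(2·cV·n²Λ²∕β) = √(2cV)·nΛ∕√β`;
* ★★`expConcentration_of_varianceBound (hVar) : ⟨text of K1-exp⟩`;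
* ★`varianceBound_of_entropyBound (hEnt) : ⟨text of hVar⟩` (§3, appended): the log-Sobolev face implies the Poincaré face.

WHY (located by ★w4 g12's memo `K1-MESOSCOPIC-LOCATE-w4g12.md` §2 and LEAD ★w1-19936 g8's card v1.39 (c)): `HistoryTailAt` only asks a SUMMABLE
profile, so a spectral gap at the Hodge scale suffices for the crux (thesis risk (i) «Gribov geometry may give only Poincaré, not LSI» is then
harmless); this file makes the sentence «line #12's measure-side organ is a SPECTRAL GAP at the Hodge–Poincaré scale» a kernel fact once composed
with ✓`historyTailL_of_expConcentration` (see `PoincareLipschitzHistoryTailOfVarianceBound`).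

HONEST: a DOOR — it moves the organ K1 to its Poincaré face (`hVar`, uniform in the torus side and in `n ≤ β_K`); `hVar` is OPEN (no spectral-gap
statement for a continuous gauge group at weak coupling exists in print — Shen–Zhu–Zhu's Bakry–Émery bound [arXiv:2204.12737, Assumption 1.1] is
strong coupling only); nothing of K1 (any face), K2, the stubs, the crux or `HistoryTailL` is proved here.  THEOREMS ONLY, definition-free.
[cite: BakryGentilLedoux2014, Prop. 4.4.2; GromovMilman1983, Thm. 4.1; Balaban1985UV3, (3) p.256]
-/

set_option autoImplicit false

noncomputable section

open scoped BigOperators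
open MeasureTheory
open Literature.MathematicalPhysics.QuantumFieldTheory
open Literature.MathematicalPhysics.QuantumFieldTheory.Balaban1983to89
open Literature.MathematicalPhysics.QuantumFieldTheory.Balaban1983to89.T3ContinuumYM3Torus
open Literature.MathematicalPhysics.QuantumFieldTheory.Balaban1983to89.T3UnitScaleTilt
open Literature.MathematicalPhysics.QuantumFieldTheory.Balaban1983to89.T3UnitLawDensityEML
open Summit.QuantumFields.YangMills.Theorems.PoincareLipschitzMesoscopicConcentrationOfEntropy (abs_le_of_lipschitz)

namespace Summit.QuantumFields.YangMills.Theorems.PoincareLipschitzExpConcentrationOfVariance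

/-! ## §1 The scale identity -/

/-- `√(2·(cV·(n²Λ²∕β))) = √(2cV)·(nΛ)∕√β` for `cV ≥ 0`, `n, Λ ≥ 0` — the Poincaré scale `√C_P·Λ` at `C_P = cV·n²∕β_K`
(up to the factor `2` of the doubling argument). [folklore] -/
theorem sqrt_two_mul_scale {cV n Λ : ℝ} (β : ℝ) (hcV : 0 ≤ cV) (hn : 0 ≤ n) (hΛ : 0 ≤ Λ) :
    Real.sqrt (2 * (cV * (n ^ 2 * Λ ^ 2 / β))) = Real.sqrt (2 * cV) * (n * Λ) / Real.sqrt β := by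
  have h1 : 2 * (cV * (n ^ 2 * Λ ^ 2 / β)) = (2 * cV) * ((n * Λ) ^ 2 / β) := by ring
  rw [h1, Real.sqrt_mul (by positivity), Real.sqrt_div (sq_nonneg _), Real.sqrt_sq (mul_nonneg hn hΛ)]
  ring

/-! ## §2 The Poincaré door -/

/-- ★★ **K1-exp ⟸ THE VARIANCE BOUND AT THE HODGE–POINCARÉ SCALE (Gromov–Milman ∕ Aida–Stroock).**  Suppose that for every `L` there are
`cV > 0` and `γ₁ ∈ (0,1]` such that for every `T3Family F` with `F.L = L`, every `γ ∈ (0,γ₁]`, every `K`, every box side `1 ≤ n ≤ β_K` with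
`2n ≤ sitesPerDir`, every corner `x₀`, every measurable gauge-invariant `f` depending only on the bonds of the box `x₀ + [0,n)³` and `Λ`-Lipschitz
(`Λ > 0`) in the `ℓ²` link metric, and every real `l`:
`∫ e^{lf} d gibbsK − (∫ e^{(l∕2)f} d gibbsK)² ≤ cV·(n²Λ²∕β_K)·l²·∫ e^{lf} d gibbsK`
(what a Poincaré inequality for `gibbsK` with constant `≍ n²∕β_K` on this class gives for `e^{lf∕2}`, `|∇f| ≤ Λ`).  THEN the text K1-exp
(= `PoincareLipschitz.MesoscopicConcentrationL` with the exponential profile; = the hypothesis `hC` of ✓`historyTailL_of_expConcentration`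
VERBATIM) holds with `Cc = e²`, `cc = 1∕√(2cV)` and the same `γ₁`:
`gibbsK{r ≤ f − ∫f} ≤ e²·exp(−(1∕√(2cV))·√β_K·r∕(n·Λ))`.  Proof: the class is bounded (✓`abs_le_of_lipschitz`), so the tree's kernel-proved
Gromov–Milman ∕ Aida–Stroock argument ✓`Literature.Probability.Moments.poincare_laplace_and_tail_bound` applies with `c := cV·n²Λ²∕β_K`, and
`r∕√(2c) = √β_K·r∕(√(2cV)·n·Λ)` (`sqrt_two_mul_scale`).  A DOOR: `hVar` is the organ K1 in its spectral-gap form and is NOT proved.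
[cite: BakryGentilLedoux2014, Prop. 4.4.2; GromovMilman1983, Thm. 4.1] -/
theorem expConcentration_of_varianceBound
    (hVar : ∀ (L : ℕ), ∃ cV : ℝ, 0 < cV ∧ ∃ γ₁ : ℝ, 0 < γ₁ ∧ γ₁ ≤ 1 ∧
      ∀ (F : T3Family) (γ : ℝ), F.L = L → 0 < γ → γ ≤ γ₁ → ∀ (K n : ℕ), 1 ≤ n →
        (n : ℝ) ≤ (F.scheme ℰp γ).β K → 2 * n ≤ (F.P K).sitesPerDir 0 →
        ∀ (x₀ : Site (F.P K) 0) (f : GaugeField (F.P K) 0 (Matrix.specialUnitaryGroup (Fin 2) ℂ) → ℝ) (Λ : ℝ), 0 < Λ →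
          Measurable f → GaugeField.GaugeInvariant f →
          (∀ U U' : GaugeField (F.P K) 0 (Matrix.specialUnitaryGroup (Fin 2) ℂ),
            (∀ b : PBond (F.P K) 0, (∀ k, (b.src k - x₀ k).val < n) → (∀ k, (b.tgt k - x₀ k).val < n) → U b = U' b) →
              f U = f U') →
          (∀ U U' : GaugeField (F.P K) 0 (Matrix.specialUnitaryGroup (Fin 2) ℂ),
            |f U - f U'| ≤ Λ * Real.sqrt (∑ b : PBond (F.P K) 0, GaugeGroup.dist1 (U b * (U' b)⁻¹) ^ 2)) →
          ∀ l : ℝ,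
            ∫ U, Real.exp (l * f U) ∂(gibbsK F ℰp γ K) - (∫ U, Real.exp (l / 2 * f U) ∂(gibbsK F ℰp γ K)) ^ 2 ≤
              cV * ((n : ℝ) ^ 2 * Λ ^ 2 / (F.scheme ℰp γ).β K) * l ^ 2 * ∫ U, Real.exp (l * f U) ∂(gibbsK F ℰp γ K)) :
    ∀ (L : ℕ), ∃ (Cc cc : ℝ), 0 ≤ Cc ∧ 0 < cc ∧ ∃ γ₁ : ℝ, 0 < γ₁ ∧ γ₁ ≤ 1 ∧
      ∀ (F : T3Family) (γ : ℝ), F.L = L → 0 < γ → γ ≤ γ₁ → ∀ (K n : ℕ), 1 ≤ n →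
        (n : ℝ) ≤ (F.scheme ℰp γ).β K → 2 * n ≤ (F.P K).sitesPerDir 0 →
        ∀ (x₀ : Site (F.P K) 0) (f : GaugeField (F.P K) 0 (Matrix.specialUnitaryGroup (Fin 2) ℂ) → ℝ) (Λ : ℝ), 0 < Λ →
          Measurable f → GaugeField.GaugeInvariant f →
          (∀ U U' : GaugeField (F.P K) 0 (Matrix.specialUnitaryGroup (Fin 2) ℂ),
            (∀ b : PBond (F.P K) 0, (∀ k, (b.src k - x₀ k).val < n) → (∀ k, (b.tgt k - x₀ k).val < n) → U b = U' b) →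
              f U = f U') →
          (∀ U U' : GaugeField (F.P K) 0 (Matrix.specialUnitaryGroup (Fin 2) ℂ),
            |f U - f U'| ≤ Λ * Real.sqrt (∑ b : PBond (F.P K) 0, GaugeGroup.dist1 (U b * (U' b)⁻¹) ^ 2)) →
          ∀ r : ℝ, 0 ≤ r →
            (gibbsK F ℰp γ K).real {U | r ≤ f U - ∫ V, f V ∂(gibbsK F ℰp γ K)} ≤
              Cc * Real.exp (-(cc * Real.sqrt ((F.scheme ℰp γ).β K) * r / ((n : ℝ) * Λ))) := by
  intro L
  obtain ⟨cV, hcV, γ₁, hγ₁, hγ₁1, H⟩ := hVar L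
  refine ⟨Real.exp 2, 1 / Real.sqrt (2 * cV), (Real.exp_pos 2).le, by positivity, γ₁, hγ₁, hγ₁1, ?_⟩
  intro F γ hFL hγ hγ₁' K n hn hnβ h2n x₀ f Λ hΛ hfm hinv hloc hLip r _hr
  haveI := isProbabilityMeasure_gibbsK F ℰp hγ.le K
  set μ := gibbsK F ℰp γ K with hμ
  set β : ℝ := (F.scheme ℰp γ).β K with hβ
  have hn0 : (0 : ℝ) < (n : ℝ) := by exact_mod_cast (Nat.lt_of_lt_of_le Nat.zero_lt_one hn)
  have hβ0 : 0 < β := by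
    have hβe : β = (γ * (F.P K).eps)⁻¹ := rfl
    rw [hβe]
    exact inv_pos.2 (mul_pos hγ (F.P K).eps_pos)
  -- the Poincaré constant at the Hodge–Poincaré scale
  set c : ℝ := cV * ((n : ℝ) ^ 2 * Λ ^ 2 / β) with hc
  have hc0 : 0 < c := by positivity
  have hbdd : ∃ C : ℝ, ∀ U, |f U| ≤ C :=
    ⟨|f 1| + Λ * Real.sqrt (∑ _b : PBond (F.P K) 0, (2 : ℝ) ^ 2), abs_le_of_lipschitz f hΛ.le hLip⟩
  have hVar' : ∀ l : ℝ, ∫ U, Real.exp (l * f U) ∂μ - (∫ U, Real.exp (l / 2 * f U) ∂μ) ^ 2 ≤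
      c * l ^ 2 * ∫ U, Real.exp (l * f U) ∂μ := by
    intro l
    rw [hμ, hc, hβ]
    exact H F γ hFL hγ hγ₁' K n hn hnβ h2n x₀ f Λ hΛ hfm hinv hloc hLip l
  have htail := (Literature.Probability.Moments.poincare_laplace_and_tail_bound μ hfm hbdd hc0 hVar').2 r
  refine htail.trans (le_of_eq ?_)
  congr 1
  rw [hc, sqrt_two_mul_scale β hcV.le hn0.le hΛ.le]
  have h2 : 0 < Real.sqrt (2 * cV) := Real.sqrt_pos.2 (by positivity)
  have hβs : 0 < Real.sqrt β := Real.sqrt_pos.2 hβ0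
  congr 1
  field_simp

/-! ## §3 The hierarchy door: the entropy (log-Sobolev) face implies the variance (Poincaré) face -/

/-- ★ **`hVar ⟸ hEnt` — THE LOG-SOBOLEV FACE OF K1 IMPLIES ITS POINCARÉ FACE, BY KERNEL.**  The hypothesis is ★w4 g12's `hEnt` of
✓`PoincareLipschitzMesoscopicConcentrationOfEntropy.mesoscopicConcentrationL_of_entropyBound` VERBATIM (the entropy bound
`Ent_{gibbsK}(e^{lf}) ≤ cE·(n²Λ²∕β_K)·l²·∫ e^{lf}` on the K1 class); the conclusion is the hypothesis `hVar` of `expConcentration_of_varianceBound`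
VERBATIM with `cV := cE` (the variance bound `∫ e^{lf} − (∫ e^{(l∕2)f})² ≤ cE·(n²Λ²∕β_K)·l²·∫ e^{lf}`).  Proof: the class is bounded
(✓`abs_le_of_lipschitz`), Herbst gives the sub-Gaussian Laplace bound, and Jensen + `e^x(1−x) ≤ 1` turn it into the variance bound with the same
constant (lit ✓`Literature.Probability.Moments.variance_le_of_entropy_le`).  So the four typed faces of line #12's measure-side organ are ordered by
kernel: ENTROPY (`hEnt`) ⟹ {GAUSSIAN TAIL (registered 23532, ✓p699890), VARIANCE (`hVar`, this theorem)} ⟹ EXPONENTIAL TAIL (K1-exp, ✓p700135's `hC`;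
✓`expTail_of_gaussTail`, ✓`expConcentration_of_varianceBound`) ⟹ (with K2, `MeanDeviationL`) `HistoryTailL`.  A door between two OPEN hypotheses;
nothing of K1 is proved. [cite: BakryGentilLedoux2014, Prop. 5.4.1 and Prop. 4.4.2] -/
theorem varianceBound_of_entropyBound
    (hEnt : ∀ (L : ℕ), ∃ cE : ℝ, 0 < cE ∧ ∃ γ₁ : ℝ, 0 < γ₁ ∧ γ₁ ≤ 1 ∧
      ∀ (F : T3Family) (γ : ℝ), F.L = L → 0 < γ → γ ≤ γ₁ → ∀ (K n : ℕ), 1 ≤ n →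
        (n : ℝ) ≤ (F.scheme ℰp γ).β K → 2 * n ≤ (F.P K).sitesPerDir 0 →
        ∀ (x₀ : Site (F.P K) 0) (f : GaugeField (F.P K) 0 (Matrix.specialUnitaryGroup (Fin 2) ℂ) → ℝ) (Λ : ℝ), 0 < Λ →
          Measurable f → GaugeField.GaugeInvariant f →
          (∀ U U' : GaugeField (F.P K) 0 (Matrix.specialUnitaryGroup (Fin 2) ℂ),
            (∀ b : PBond (F.P K) 0, (∀ k, (b.src k - x₀ k).val < n) → (∀ k, (b.tgt k - x₀ k).val < n) → U b = U' b) →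
              f U = f U') →
          (∀ U U' : GaugeField (F.P K) 0 (Matrix.specialUnitaryGroup (Fin 2) ℂ),
            |f U - f U'| ≤ Λ * Real.sqrt (∑ b : PBond (F.P K) 0, GaugeGroup.dist1 (U b * (U' b)⁻¹) ^ 2)) →
          ∀ l : ℝ,
            ∫ U, Real.exp (l * f U) * (l * f U) ∂(gibbsK F ℰp γ K) -
                (∫ U, Real.exp (l * f U) ∂(gibbsK F ℰp γ K)) * Real.log (∫ U, Real.exp (l * f U) ∂(gibbsK F ℰp γ K)) ≤
              cE * ((n : ℝ) ^ 2 * Λ ^ 2 / (F.scheme ℰp γ).β K) * l ^ 2 * ∫ U, Real.exp (l * f U) ∂(gibbsK F ℰp γ K)) :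
    ∀ (L : ℕ), ∃ cV : ℝ, 0 < cV ∧ ∃ γ₁ : ℝ, 0 < γ₁ ∧ γ₁ ≤ 1 ∧
      ∀ (F : T3Family) (γ : ℝ), F.L = L → 0 < γ → γ ≤ γ₁ → ∀ (K n : ℕ), 1 ≤ n →
        (n : ℝ) ≤ (F.scheme ℰp γ).β K → 2 * n ≤ (F.P K).sitesPerDir 0 →
        ∀ (x₀ : Site (F.P K) 0) (f : GaugeField (F.P K) 0 (Matrix.specialUnitaryGroup (Fin 2) ℂ) → ℝ) (Λ : ℝ), 0 < Λ →
          Measurable f → GaugeField.GaugeInvariant f →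
          (∀ U U' : GaugeField (F.P K) 0 (Matrix.specialUnitaryGroup (Fin 2) ℂ),
            (∀ b : PBond (F.P K) 0, (∀ k, (b.src k - x₀ k).val < n) → (∀ k, (b.tgt k - x₀ k).val < n) → U b = U' b) →
              f U = f U') →
          (∀ U U' : GaugeField (F.P K) 0 (Matrix.specialUnitaryGroup (Fin 2) ℂ),
            |f U - f U'| ≤ Λ * Real.sqrt (∑ b : PBond (F.P K) 0, GaugeGroup.dist1 (U b * (U' b)⁻¹) ^ 2)) →
          ∀ l : ℝ,
            ∫ U, Real.exp (l * f U) ∂(gibbsK F ℰp γ K) - (∫ U, Real.exp (l / 2 * f U) ∂(gibbsK F ℰp γ K)) ^ 2 ≤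
              cV * ((n : ℝ) ^ 2 * Λ ^ 2 / (F.scheme ℰp γ).β K) * l ^ 2 * ∫ U, Real.exp (l * f U) ∂(gibbsK F ℰp γ K) := by
  intro L
  obtain ⟨cE, hcE, γ₁, hγ₁, hγ₁1, H⟩ := hEnt L
  refine ⟨cE, hcE, γ₁, hγ₁, hγ₁1, ?_⟩
  intro F γ hFL hγ hγ₁' K n hn hnβ h2n x₀ f Λ hΛ hfm hinv hloc hLip l
  haveI := isProbabilityMeasure_gibbsK F ℰp hγ.le K
  set μ := gibbsK F ℰp γ K with hμ
  set β : ℝ := (F.scheme ℰp γ).β K with hβ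
  have hn0 : (0 : ℝ) < (n : ℝ) := by exact_mod_cast (Nat.lt_of_lt_of_le Nat.zero_lt_one hn)
  have hβ0 : 0 < β := by
    have hβe : β = (γ * (F.P K).eps)⁻¹ := rfl
    rw [hβe]
    exact inv_pos.2 (mul_pos hγ (F.P K).eps_pos)
  set c : ℝ := cE * ((n : ℝ) ^ 2 * Λ ^ 2 / β) with hc
  have hc0 : 0 < c := by positivity
  have hEnt' : ∀ l' : ℝ, ∫ U, Real.exp (l' * f U) * (l' * f U) ∂μ -
      (∫ U, Real.exp (l' * f U) ∂μ) * Real.log (∫ U, Real.exp (l' * f U) ∂μ) ≤ c * l' ^ 2 * ∫ U, Real.exp (l' * f U) ∂μ := by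
    intro l'
    rw [hμ, hc, hβ]
    exact H F γ hFL hγ hγ₁' K n hn hnβ h2n x₀ f Λ hΛ hfm hinv hloc hLip l'
  exact Literature.Probability.Moments.variance_le_of_entropy_le μ hfm (abs_le_of_lipschitz f hΛ.le hLip) hc0 hEnt' l

end Summit.QuantumFields.YangMills.Theorems.PoincareLipschitzExpConcentrationOfVariance

end
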